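import Mathlib
import Literature.MathematicalPhysics.MHD.SolovevFluxSurfaceGGJDerivs
import Literature.MathematicalPhysics.MHD.MercierFluxForm
import HarnessLib

/-!
# The thirteen GGJ / Mercier (8.134) inputs of every Lee–Cerfon / PCF Solov'ev surface as ONE
# `Mercier.FluxForm.SurfaceData`, built from the tree's functionals, with every field PROVED equal to an
# explicit one-dimensional integral (the input bridge for per-surface Mercier certificates)

Seventh file of the `lcLoop` series (gridfusion-model-5). The typed criterion is gridfusion-lit-3's
`MercierFluxForm.lean` (Jardin 2010 (8.134) verbatim on a `SurfaceData` record of thirteen reals; bib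
`Jardin2010`); the functionals are `FluxSurfaceAverage.lean` (Jardin (5.29)–(5.35) = Freidberg
(6.22)/(6.27)/(6.35)); the per-surface reductions on the printed loop `lcLoop R₀ κ r` of
`Ψ = psiLC κ F_B R₀ q₀ a` [Lee–Cerfon 2015 §4.1, bib `LeeCerfon2015`] are `SolovevFluxSurfaceGGJAverages.lean`
/ `…Derivs.lean`.

CONVENTIONS (stated once, used consistently — the RULE of `MercierFluxForm.lean` §8): label `ψ := Ψ`
(the flux function itself); JARDIN's orientation `B = ∇φ × ∇Ψ + g∇φ` (5.24), so the physical poloidal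
flux is `Ψ_p = 2πΨ` (5.32) ⇒ `Ψ′ = 2π`, `Ψ″ = 0`; `μ₀RJ_φ = Δ*Ψ` (Jardin (4.55)) ⇒ for a constant free
function `F ≡ g` (Solov'ev, `gg′ = 0`, `K′ = 0`) the parallel-current density satisfies
`σB² = J·B = J_φB_φ = gΔ*Ψ/R²` (rationalised `μ₀ → 1` as in (8.134)); and `μ₀p′ = −Δ*Ψ/R²` from the
Grad–Shafranov equation, i.e. `p′ = −C_s` for the Lee–Cerfon source constant `C_s = csLC`
(`gsOperator_psiLC`, `isSolovevProfile_LC`). The tree's own `GradShafranov.fieldBR/muJphi` are in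
FREIDBERG's (mirror) orientation; by `Mercier.FluxForm.SurfaceData.mercierF_mirror` the criterion is the
same for `(lcGGJData …).mirror` — never mix.

* `lcLabel`, `lcRadius` — `Ψ_s(r) = cR₀²(r² − a²)` and its inverse `r(s) = (a² + s/(cR₀²))^{1/2}`;
* `lcGGJData κ F_B R₀ q₀ a g r : SurfaceData` — `V′ = volumeDerivE`, `V″ = d/dΨ_s` of it (a literal
  `deriv` through `lcRadius`), `Ψ′ = 2π`, `Ψ″ = 0`, `Φ′ = toroidalFluxDerivJ g` (5.31), `Φ″ = d/dΨ_s` of it,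
  `I′ = d/dΨ_s` of `toroidalCurrentJ 1` (5.34), `K′ = 0`, `p′ = −C_s`, and the four averages as
  `surfaceAverageE` of `B²/|∇Ψ|²`, `(gΔ*Ψ/R²)/|∇Ψ|²`, `(gΔ*Ψ/R²)²/(B²|∇Ψ|²)`, `1/B²` with
  `B² = fieldBsq (F ≡ g)`;
* PROVED field by field (every surface `0 < r < R₀/2`; `κ, F_B, q₀, R₀ > 0`; any `g`):
  `V′ = 2π∫₀^{2π} w`, `V″ = 2π∫₀^{2π} ∂w/∂r ÷ (2cR₀²r)`, `Φ′ = 2π(g/F_B)·(q₀R₀³/π)∫₀^π(u√u)⁻¹`,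
  `Φ″ = 2π(g/F_B)·(q₀R₀³/π)∫₀^π lcQKernelDr ÷ (2cR₀²r)`, `σB² ≡ C_s g` along the loop,
  `gσB2 = C_s g·∫w/G ÷ ∫w`, `gσ2B2 = (C_s g)²·∫uw/((g²+G)G) ÷ ∫w`, `gB2 = ∫(g²+G)w/(uG) ÷ ∫w`,
  `invB2 = ∫uw/(g²+G) ÷ ∫w` (`w = lcAvgWeight`, `G = lcGradSq`);
* `mercierF_lcGGJData` — Jardin's `F` of this surface in the poloidal-flux-label form
  (`mercierF_of_poloidalFluxLabel (c := 2π)`): the `I′` field drops out (`Ψ″ = 0`).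

NOT here: the surface-averaged force balance `p′V′ + I′Ψ′ − K′Φ′ = 0` for these data (i.e.
`dI/dΨ = C_sV′/(2π)` on the family) — expected, not yet proved; certified enclosures (Bench, two lineages);
any stability claim (three columns: this is exact real analysis about MODEL objects).
Typer/prover: gridfusion-model-5 (g3), 2026-08-27.
-/

noncomputable section

namespace Literature.MathematicalPhysics.MHD.Solovev

open GradShafranov FluxGeometry Mercier.FluxForm _root_.Real MeasureTheory intervalIntegral _root_.Set
  _root_.Filter
open scoped _root_.Topology

/-! ## The two labels -/

/-- The flux label of the surface of minor-radius label `r`: `Ψ_s(r) = cR₀²(r² − a²)`, `c = κF_B/(2R₀³q₀)`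
(`psiLC_lcLoop`). [cite: LeeCerfon2015, §4.1] -/
def lcLabel (κ FB R₀ q₀ a r : ℝ) : ℝ := κ * FB / (2 * R₀ ^ 3 * q₀) * (R₀ ^ 2 * (r ^ 2 - a ^ 2))

/-- The inverse label map `r(s) = (a² + s/(cR₀²))^{1/2}` (`hasDerivAt_lcRadius`). [cite: LeeCerfon2015, §4.1] -/
def lcRadius (κ FB R₀ q₀ a s : ℝ) : ℝ := Real.sqrt (a ^ 2 + s / (κ * FB / (2 * R₀ ^ 3 * q₀) * R₀ ^ 2))

/-- `Ψ` on the loop is the label: `Ψ(γ_r(t)) = Ψ_s(r)`. [cite: LeeCerfon2015, §4.1] -/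
theorem psiLC_lcLoop_eq_lcLabel {R₀ r κ : ℝ} (hR₀ : 0 < R₀) (hr : 0 ≤ r) (h2r : 2 * r < R₀) (hκ : κ ≠ 0)
    (FB q₀ a t : ℝ) :
    psiLC κ FB R₀ q₀ a (lcLoop R₀ κ r t).1 (lcLoop R₀ κ r t).2 = lcLabel κ FB R₀ q₀ a r :=
  psiLC_lcLoop hR₀ hr h2r hκ FB q₀ a t

/-- `r(Ψ_s(r)) = r` for `r > 0` (`c, R₀ ≠ 0`). [cite: LeeCerfon2015, §4.1] -/
theorem lcRadius_lcLabel {κ FB R₀ q₀ a r : ℝ} (hc : κ * FB / (2 * R₀ ^ 3 * q₀) ≠ 0) (hR₀ : R₀ ≠ 0)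
    (hr : 0 < r) : lcRadius κ FB R₀ q₀ a (lcLabel κ FB R₀ q₀ a r) = r :=
  (hasDerivAt_lcRadius (a := a) hc hR₀ hr).1

/-! ## The surface data record -/

/-- THE GGJ / MERCIER (8.134) INPUTS OF THE LEE–CERFON SURFACE `r` (`0 < r < R₀/2`) of
`Ψ = psiLC κ F_B R₀ q₀ a` with constant free function `F ≡ g`, in the label `ψ := Ψ` and JARDIN's
orientation (`Ψ_p = 2πΨ`, `μ₀RJ_φ = Δ*Ψ`, rationalised `μ₀ → 1`): `V′ = dV/dΨ` (5.29)/(6.22);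
`V″ = dV′/dΨ_s` (a derivative along the family through `lcRadius`); `Ψ′ = 2π`, `Ψ″ = 0` (5.32);
`Φ′ = (1/2π)gV′⟨R⁻²⟩` (5.31), `Φ″ = dΦ′/dΨ_s`; `I′ = dI/dΨ_s`, `I` = (5.34) (`μ₀ = 1`); `K′ = 0`
(5.33, `g′ = 0`); `p′ = −C_s` (`μ₀p′ = −Δ*Ψ/R²`, `gsOperator_psiLC`); `⟨B²/|∇Ψ|²⟩`, `⟨σB²/|∇Ψ|²⟩`,
`⟨σ²B²/|∇Ψ|²⟩`, `⟨1/B²⟩` with `σB² = J·B = gΔ*Ψ/R²` and `B² = (g² + |∇Ψ|²)/R²`. MODELLED: ideal MHD,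
Solov'ev profiles, analytic fixed boundary. [cite: Jardin2010, §8.5.4 eq. (8.134)] -/
def lcGGJData (κ FB R₀ q₀ a g r : ℝ) : SurfaceData where
  V' := volumeDerivE (psiLC κ FB R₀ q₀ a) (lcLoop R₀ κ r) (2 * π)
  V'' := deriv (fun s => volumeDerivE (psiLC κ FB R₀ q₀ a) (lcLoop R₀ κ (lcRadius κ FB R₀ q₀ a s))
    (2 * π)) (lcLabel κ FB R₀ q₀ a r)
  Ψ' := 2 * π
  Ψ'' := 0
  Φ' := toroidalFluxDerivJ g (psiLC κ FB R₀ q₀ a) (lcLoop R₀ κ r) (2 * π)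
  Φ'' := deriv (fun s => toroidalFluxDerivJ g (psiLC κ FB R₀ q₀ a)
    (lcLoop R₀ κ (lcRadius κ FB R₀ q₀ a s)) (2 * π)) (lcLabel κ FB R₀ q₀ a r)
  I' := deriv (fun s => toroidalCurrentJ 1 (psiLC κ FB R₀ q₀ a)
    (lcLoop R₀ κ (lcRadius κ FB R₀ q₀ a s)) (2 * π)) (lcLabel κ FB R₀ q₀ a r)
  K' := 0
  p' := -csLC κ FB R₀ q₀
  gB2 := surfaceAverageE (psiLC κ FB R₀ q₀ a) (lcLoop R₀ κ r) (2 * π)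
    (fun R Z => fieldBsq (fun _ => g) (psiLC κ FB R₀ q₀ a) R Z / gradSq (psiLC κ FB R₀ q₀ a) R Z)
  gσB2 := surfaceAverageE (psiLC κ FB R₀ q₀ a) (lcLoop R₀ κ r) (2 * π)
    (fun R Z => g * gsOperator (psiLC κ FB R₀ q₀ a) R Z / R ^ 2 / gradSq (psiLC κ FB R₀ q₀ a) R Z)
  gσ2B2 := surfaceAverageE (psiLC κ FB R₀ q₀ a) (lcLoop R₀ κ r) (2 * π)
    (fun R Z => (g * gsOperator (psiLC κ FB R₀ q₀ a) R Z / R ^ 2) ^ 2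
      / (fieldBsq (fun _ => g) (psiLC κ FB R₀ q₀ a) R Z * gradSq (psiLC κ FB R₀ q₀ a) R Z))
  invB2 := surfaceAverageE (psiLC κ FB R₀ q₀ a) (lcLoop R₀ κ r) (2 * π)
    (fun R Z => 1 / fieldBsq (fun _ => g) (psiLC κ FB R₀ q₀ a) R Z)

/-! ## Field by field: explicit one-dimensional integrals -/

/-- `q` scales linearly in the free constant: `safetyFactorE g Ψ γ T = (g/F_B)·safetyFactorE F_B Ψ γ T`
(`F_B ≠ 0`). [cite: Freidberg2014, §6.3.5 eq. (6.35)] -/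
theorem safetyFactorE_smul {FB : ℝ} (hFB : FB ≠ 0) (g : ℝ) (ψ : ℝ → ℝ → ℝ) (γ : ℝ → ℝ × ℝ) (T : ℝ) :
    safetyFactorE g ψ γ T = g / FB * safetyFactorE FB ψ γ T := by
  unfold safetyFactorE
  field_simp

section fields

variable {R₀ κ FB q₀ r : ℝ} (hR₀ : 0 < R₀) (hκ : 0 < κ) (hFB : 0 < FB) (hq₀ : 0 < q₀)
  (hr : 0 < r) (h2r : 2 * r < R₀)
include hR₀ hκ hFB hq₀ hr h2r

/-- `V′ = 2π∫₀^{2π} w dt`. [cite: Jardin2010, §5.3 eq. (5.29)] -/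
theorem lcGGJData_V' (a g : ℝ) :
    (lcGGJData κ FB R₀ q₀ a g r).V' = 2 * π * ∫ t in (0 : ℝ)..(2 * π), lcAvgWeight κ FB R₀ q₀ r t :=
  volumeDerivE_lcLoop_eq hR₀ hκ hFB hq₀ hr h2r a

/-- `V′ ≠ 0` (regular surface). [cite: Jardin2010, §5.3 eq. (5.29)] -/
theorem lcGGJData_V'_ne (a g : ℝ) : (lcGGJData κ FB R₀ q₀ a g r).V' ≠ 0 :=
  (volumeDerivE_lcLoop_pos hR₀ hκ hFB hq₀ hr h2r a).ne'

/-- `V″ = dV′/dΨ_s = (2π∫₀^{2π} ∂w/∂r dt)/(2cR₀²r)`. [cite: Jardin2010, §8.5.4 eq. (8.134)] -/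
theorem lcGGJData_V'' (a g : ℝ) :
    (lcGGJData κ FB R₀ q₀ a g r).V''
      = (2 * π * ∫ t in (0 : ℝ)..(2 * π), lcAvgWeightDr κ FB R₀ q₀ r t)
          / (2 * (κ * FB / (2 * R₀ ^ 3 * q₀)) * R₀ ^ 2 * r) := by
  have hc : κ * FB / (2 * R₀ ^ 3 * q₀) ≠ 0 := by positivity
  have h := hasDerivAt_comp_lcRadius (a := a) hc hR₀.ne' hr
    (hasDerivAt_volumeDerivE_lcLoop hR₀ hκ hFB hq₀ hr h2r a).2
  exact h.deriv

/-- `Φ′ = 2πq(g) = 2π(g/F_B)(q₀R₀³/π)∫₀^π (u√u)⁻¹ dt`. [cite: Jardin2010, §5.3 eq. (5.31)] -/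
theorem lcGGJData_Φ' (a g : ℝ) :
    (lcGGJData κ FB R₀ q₀ a g r).Φ'
      = 2 * π * (g / FB * (q₀ * R₀ ^ 3 / π
          * ∫ t in (0 : ℝ)..π, (lcU R₀ r t * Real.sqrt (lcU R₀ r t))⁻¹)) := by
  show toroidalFluxDerivJ g _ _ _ = _
  rw [toroidalFluxDerivJ_eq (lcGGJData_V'_ne hR₀ hκ hFB hq₀ hr h2r a g),
    safetyFactorE_smul hFB.ne', safetyFactorE_lcLoop hR₀ hκ hFB hq₀ hr h2r a]

/-- `r ↦ Φ′` has derivative `2π(g/F_B)(q₀R₀³/π)∫₀^π lcQKernelDr dt`. [cite: Jardin2010, §8.5.4 eq. (8.134)] -/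
theorem hasDerivAt_toroidalFluxDerivJ_lcLoop (a g : ℝ) :
    HasDerivAt (fun ρ => toroidalFluxDerivJ g (psiLC κ FB R₀ q₀ a) (lcLoop R₀ κ ρ) (2 * π))
      (2 * π * (g / FB * (q₀ * R₀ ^ 3 / π * ∫ t in (0 : ℝ)..π, lcQKernelDr R₀ r t))) r := by
  have hs : Ioo 0 (R₀ / 2) ∈ 𝓝 r := Ioo_mem_nhds hr (by linarith)
  have hev : (fun ρ => toroidalFluxDerivJ g (psiLC κ FB R₀ q₀ a) (lcLoop R₀ κ ρ) (2 * π))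
      =ᶠ[𝓝 r] fun ρ => 2 * π * (g / FB * safetyFactorE FB (psiLC κ FB R₀ q₀ a) (lcLoop R₀ κ ρ) (2 * π)) :=
    Filter.eventually_of_mem hs fun x hx => by
      have h2x : 2 * x < R₀ := by linarith [hx.2]
      beta_reduce
      rw [toroidalFluxDerivJ_eq (volumeDerivE_lcLoop_pos hR₀ hκ hFB hq₀ hx.1 h2x a).ne',
        safetyFactorE_smul hFB.ne']
  exact (((hasDerivAt_safetyFactorE_lcLoop hR₀ hκ hFB hq₀ hr h2r a).2.const_mul (g / FB)).const_mul
    (2 * π)).congr_of_eventuallyEq hev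

/-- `Φ″ = dΦ′/dΨ_s = 2π(g/F_B)(q₀R₀³/π)∫₀^π lcQKernelDr dt ÷ (2cR₀²r)` (`= 2π dq/dΨ`).
[cite: Jardin2010, §8.5.4 eq. (8.134)] -/
theorem lcGGJData_Φ'' (a g : ℝ) :
    (lcGGJData κ FB R₀ q₀ a g r).Φ''
      = 2 * π * (g / FB * (q₀ * R₀ ^ 3 / π * ∫ t in (0 : ℝ)..π, lcQKernelDr R₀ r t))
          / (2 * (κ * FB / (2 * R₀ ^ 3 * q₀)) * R₀ ^ 2 * r) := by
  have hc : κ * FB / (2 * R₀ ^ 3 * q₀) ≠ 0 := by positivity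
  have h := hasDerivAt_comp_lcRadius (a := a) hc hR₀.ne' hr
    (hasDerivAt_toroidalFluxDerivJ_lcLoop hR₀ hκ hFB hq₀ hr h2r a g)
  exact h.deriv

omit hFB in
/-- Along the loop `σB² = gΔ*Ψ/R² ≡ C_s g` (a surface — indeed global — constant).
[cite: LeeCerfon2015, §4.1 eq. (solo2)] -/
theorem sigmaBsq_lcLoop (a g t : ℝ) :
    g * gsOperator (psiLC κ FB R₀ q₀ a) (lcLoop R₀ κ r t).1 (lcLoop R₀ κ r t).2 / (lcLoop R₀ κ r t).1 ^ 2
      = csLC κ FB R₀ q₀ * g := by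
  have hu := lcU_pos hR₀ hr.le h2r t
  have hs : 0 < Real.sqrt (lcU R₀ r t) := Real.sqrt_pos.2 hu
  have h1 : (lcLoop R₀ κ r t).1 = Real.sqrt (lcU R₀ r t) := rfl
  rw [h1, gsOperator_psiLC _ hs.ne' hR₀.ne' hκ.ne' hq₀.ne']
  field_simp

/-- `⟨σB²/|∇Ψ|²⟩ = C_s g · ∫ w/G dt ÷ ∫ w dt`. [cite: Jardin2010, §8.5.4 eq. (8.134)] -/
theorem lcGGJData_gσB2 (a g : ℝ) :
    (lcGGJData κ FB R₀ q₀ a g r).gσB2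
      = csLC κ FB R₀ q₀ * g
          * ((∫ t in (0 : ℝ)..(2 * π), lcAvgWeight κ FB R₀ q₀ r t / lcGradSq κ FB R₀ q₀ r t)
            / ∫ t in (0 : ℝ)..(2 * π), lcAvgWeight κ FB R₀ q₀ r t) := by
  rw [← surfaceAverageE_lcLoop_invGradSq hR₀ hκ hFB hq₀ hr h2r a]
  refine surfaceAverageE_of_const_mul fun t _ => ?_
  rw [sigmaBsq_lcLoop hR₀ hκ hq₀ hr h2r a g t, one_div, div_eq_mul_inv]

/-- `⟨σ²B²/|∇Ψ|²⟩ = (C_s g)² · ∫ u w/((g²+G)G) dt ÷ ∫ w dt`. [cite: Jardin2010, §8.5.4 eq. (8.134)] -/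
theorem lcGGJData_gσ2B2 (a g : ℝ) :
    (lcGGJData κ FB R₀ q₀ a g r).gσ2B2
      = (csLC κ FB R₀ q₀ * g) ^ 2
          * ((∫ t in (0 : ℝ)..(2 * π), lcU R₀ r t
              / ((g ^ 2 + lcGradSq κ FB R₀ q₀ r t) * lcGradSq κ FB R₀ q₀ r t) * lcAvgWeight κ FB R₀ q₀ r t)
            / ∫ t in (0 : ℝ)..(2 * π), lcAvgWeight κ FB R₀ q₀ r t) := by
  rw [← surfaceAverageE_lcLoop_invBsqGradSq hR₀ hκ hFB hq₀ hr h2r g a]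
  refine surfaceAverageE_of_const_mul fun t _ => ?_
  rw [sigmaBsq_lcLoop hR₀ hκ hq₀ hr h2r a g t, one_div, div_eq_mul_inv]

/-- `⟨B²/|∇Ψ|²⟩ = ∫ (g²+G)w/(uG) dt ÷ ∫ w dt`. [cite: Jardin2010, §8.5.4 eq. (8.134)] -/
theorem lcGGJData_gB2 (a g : ℝ) :
    (lcGGJData κ FB R₀ q₀ a g r).gB2
      = (∫ t in (0 : ℝ)..(2 * π), (g ^ 2 + lcGradSq κ FB R₀ q₀ r t)
            / (lcU R₀ r t * lcGradSq κ FB R₀ q₀ r t) * lcAvgWeight κ FB R₀ q₀ r t)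
          / ∫ t in (0 : ℝ)..(2 * π), lcAvgWeight κ FB R₀ q₀ r t :=
  surfaceAverageE_lcLoop_bsqDivGradSq hR₀ hκ hFB hq₀ hr h2r g a

/-- `⟨1/B²⟩ = ∫ u w/(g²+G) dt ÷ ∫ w dt`. [cite: Jardin2010, §8.5.4 eq. (8.134)] -/
theorem lcGGJData_invB2 (a g : ℝ) :
    (lcGGJData κ FB R₀ q₀ a g r).invB2
      = (∫ t in (0 : ℝ)..(2 * π), lcU R₀ r t / (g ^ 2 + lcGradSq κ FB R₀ q₀ r t)
            * lcAvgWeight κ FB R₀ q₀ r t)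
          / ∫ t in (0 : ℝ)..(2 * π), lcAvgWeight κ FB R₀ q₀ r t :=
  surfaceAverageE_lcLoop_invBsq hR₀ hκ hFB hq₀ hr h2r g a

end fields

/-! ## Jardin's `F` of the surface -/

/-- **Jardin's `F` (8.134) of the Lee–Cerfon surface** in the poloidal-flux-label form: with `Ψ′ = 2π`,
`Ψ″ = 0`, `K′ = 0` the `I′` field drops and
`F = (2π)²Φ″²/(4V′²) + 2πΦ″⟨σB²/G⟩/V′ + (⟨σB²/G⟩² − ⟨σ²B²/G⟩⟨B²/G⟩) − p′²⟨1/B²⟩⟨B²/G⟩ + p′V″⟨B²/G⟩/V′`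
(`mercierF_of_poloidalFluxLabel`), every symbol being the explicit integral of the `lcGGJData_…` lemmas.
[cite: Jardin2010, §8.5.4 eq. (8.134)] -/
theorem mercierF_lcGGJData (κ FB R₀ q₀ a g r : ℝ) :
    (lcGGJData κ FB R₀ q₀ a g r).mercierF
      = (2 * π) ^ 2 * (lcGGJData κ FB R₀ q₀ a g r).Φ'' ^ 2 / (4 * (lcGGJData κ FB R₀ q₀ a g r).V' ^ 2)
        + 2 * π * (lcGGJData κ FB R₀ q₀ a g r).Φ'' / (lcGGJData κ FB R₀ q₀ a g r).V'
          * (lcGGJData κ FB R₀ q₀ a g r).gσB2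
        + ((lcGGJData κ FB R₀ q₀ a g r).gσB2 ^ 2
          - (lcGGJData κ FB R₀ q₀ a g r).gσ2B2 * (lcGGJData κ FB R₀ q₀ a g r).gB2)
        - (csLC κ FB R₀ q₀) ^ 2 * (lcGGJData κ FB R₀ q₀ a g r).invB2 * (lcGGJData κ FB R₀ q₀ a g r).gB2
        + 1 / (lcGGJData κ FB R₀ q₀ a g r).V'
          * (-csLC κ FB R₀ q₀ * (lcGGJData κ FB R₀ q₀ a g r).V'') * (lcGGJData κ FB R₀ q₀ a g r).gB2 := by
  rw [SurfaceData.mercierF_of_poloidalFluxLabel _ (2 * π) rfl rfl]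
  simp only [lcGGJData]
  ring

/-- The `I′` field is irrelevant to the criterion on this family (it multiplies `Ψ″ = 0`): `F` is the
same for any replacement value of `I′`. [cite: Jardin2010, §8.5.4 eq. (8.134)] -/
theorem mercierF_lcGGJData_indep_I' (κ FB R₀ q₀ a g r x : ℝ) :
    ({ lcGGJData κ FB R₀ q₀ a g r with I' := x } : SurfaceData).mercierF
      = (lcGGJData κ FB R₀ q₀ a g r).mercierF := by
  simp only [SurfaceData.mercierF, lcGGJData]
  ring

end Literature.MathematicalPhysics.MHD.Solovev
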